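import Mathlib
import Literature.Computability.AlgebraicComplexity.HessianAtOrigin
import Literature.Computability.AlgebraicComplexity.MignonRessayreBound
import Summits.ValiantsHypothesis.ValiantsHypothesis.Theorems.GrenetZeonTwoDimCoefficientsDefs
import Summits.ValiantsHypothesis.ValiantsHypothesis.Theorems.GrenetZeonTwoDimCoefficientsDualUnipotentRankTransfer

/-!
# Crux `GrenetZeon.TwoDimCoefficients` (stmt-ValiantsHypothesis-8062), stub `stub_dualUnipotent`:
# the conjectural HESSIAN RATE `rank Hess ≤ C·m²/deg` would give `m ≳ n^{3/2}`

The memo `Cruxes/TwoDimCoefficients/PROFILE-BARRIER-stub_dualUnipotent.md` (v4, val-width-8062-p2)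
isolates one statement about the unipotent trace model — CONJECTURE (H), here the HYPOTHESIS
`hC` of the theorem ("`HessianRate(C)`", inlined, no definition is introduced): for affine `m × m` matrices `A`, `B` with `det A ≡ c ≠ 0` such that
`tr(adj A·B)` is, up to an additive constant, homogeneous of degree `d ≥ 1`, the Hessian of
`tr(adj A·B)` at every point has rank `≤ C·m²/d`.  Evidence: it holds with equality for the block
chain (`…TraceChainProfile.lean`, kernel) and in every sampled instance of the constrained normal
form (memo, Addendum B2); it FAILS without the homogeneity hypothesis (`tr(X·Xᵀ)`,
`…DualUnipotentHessianBlind.lean`) and for the bare normal form without trace constraints (memo,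
B1).  It is a conjecture of this development, NOT a published fact, and is taken as a hypothesis.

* `threeHalves_of_hessianRate` — **`HessianRate(C)` ⟹ `DualUnipotentRepr n m → n³ ≤ C·m²`**
  (`n ≥ 3`): the first SUPERLINEAR bound `m ≳ n^{3/2}` in the stub's model would follow, using only
  the Mignon–Ressayre point (`rank Hess per_n = n²`), with no appeal to `HessianRankCodimTwo`;
  and by `not_dualUnipotentBound_of_hessianProfile` (`…DualUnipotentProfileBlind.lean`) this is the
  most any Hessian-profile argument can give.  The reduction is bookkeeping: `β ≠ 0` (else `per_n`
  would be constant), `tr(adj A·B) = β⁻¹·per_n − β⁻¹αc` is homogeneous of degree `n` up to the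
  constant, and `Hess(per_n) = β·Hess(tr(adj A·B))` at the Mignon–Ressayre point.

HONEST FRAMING: a CONDITIONAL result (hypothesis `HessianRate(C)` unproved); the stub
`DualUnipotentBound` (`n² ≤ C·m`) stays open even given it; `VP ≠ VNP` is not moved.

References: T. Mignon, N. Ressayre, Int. Math. Res. Not. 2004:79, Thm. 1.1 and §3 (the point and
its Hessian; tree `hess0_transl_mrPoint_perPoly`, `rank_mrHess`).
-/

-- single-conjunct layout `Summits/ValiantsHypothesis/ValiantsHypothesis`: the duplicated namespace
-- component is mandated by the tree.
set_option linter.dupNamespace false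

noncomputable section

namespace Summit.ValiantsHypothesis.ValiantsHypothesis.Cruxes.TwoDimCoefficients.DimTwoCases

open Literature.Computability.AlgebraicComplexity Matrix MvPolynomial

/-- **Conjecture (H) gives `m ≳ n^{3/2}` in the unipotent case.**  HYPOTHESIS (`hC`, the
statement `HessianRate(C)` = Conjecture (H) of the memo PROFILE-BARRIER, a conjecture of this
development, unproved, no citation exists): for all affine `m × m` `A`, `B` over
`ℂ[x_{ij}]_{i,j<n}` with `det A = c ≠ 0` and `tr(adj A·B) − a` homogeneous of degree `d ≥ 1`, at
every point `rank Hess · d ≤ C·m²`.  CONCLUSION: `DualUnipotentRepr n m → n³ ≤ C·m²` for all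
`n ≥ 3` — via the Mignon–Ressayre point only.  CONDITIONAL on `hC`. [cite: MignonRessayre2004, Thm. 1.1] -/
theorem threeHalves_of_hessianRate (C : ℕ)
    (hC : ∀ (n m d : ℕ) (A B : AffMat n m) (c a : ℂ), IsAffine A → IsAffine B → c ≠ 0 →
      A.det = MvPolynomial.C c → 1 ≤ d →
      ((A.adjugate * B).trace - MvPolynomial.C a).IsHomogeneous d →
      ∀ p : Fin n × Fin n → ℂ, (hess0 (transl p (A.adjugate * B).trace)).rank * d ≤ C * m ^ 2) :
    ∀ n : ℕ, 3 ≤ n → ∀ m : ℕ, DualUnipotentRepr n m → n ^ 3 ≤ C * m ^ 2 := by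
  intro n hn m hrep
  obtain ⟨k, rfl⟩ : ∃ k, n = k + 3 := ⟨n - 3, by omega⟩
  obtain ⟨α, β, c, A, B, hA, hB, hc, hdet, hper⟩ := hrep
  set T : MvPolynomial (Fin (k + 3) × Fin (k + 3)) ℂ := (A.adjugate * B).trace with hT
  -- `β ≠ 0`: otherwise the permanent would be the constant `α c`
  have hβ : β ≠ 0 := by
    intro hβ0
    apply perPoly_ne_C (n := k + 3) (by omega) (α * c)
    rw [hper, hdet, hβ0, map_zero, zero_mul, add_zero, ← C_mul]
  -- `T − C a` is homogeneous of degree `n` with `a = −β⁻¹ α c`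
  have hTeq : T = MvPolynomial.C β⁻¹ * perPoly (Fin (k + 3)) ℂ - MvPolynomial.C (β⁻¹ * (α * c)) := by
    rw [hper, hdet]
    have e : MvPolynomial.C β⁻¹ * MvPolynomial.C β =
        (1 : MvPolynomial (Fin (k + 3) × Fin (k + 3)) ℂ) := by
      rw [← C_mul, inv_mul_cancel₀ hβ, C_1]
    have e2 : (MvPolynomial.C (β⁻¹ * (α * c)) : MvPolynomial (Fin (k + 3) × Fin (k + 3)) ℂ) =
        MvPolynomial.C β⁻¹ * (MvPolynomial.C α * MvPolynomial.C c) := by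
      rw [C_mul, C_mul]
    rw [e2]
    linear_combination (-T) * e
  have hperh : (perPoly (Fin (k + 3)) ℂ).IsHomogeneous (k + 3) := by
    simpa [Fintype.card_fin] using perPoly_isHomogeneous (n := Fin (k + 3)) (k := ℂ)
  have hhom : (T - MvPolynomial.C (-(β⁻¹ * (α * c)))).IsHomogeneous (k + 3) := by
    rw [hTeq, map_neg, sub_neg_eq_add, sub_add_cancel]
    exact hperh.C_mul _
  -- the rate at the Mignon–Ressayre point
  have hrate := hC (k + 3) m (k + 3) A B c (-(β⁻¹ * (α * c))) hA hB hc hdet (by omega) hhom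
    (mrPoint ℂ k)
  -- the Hessian of `per_n` there is `β •` the Hessian of `T`
  have e1 : transl (mrPoint ℂ k) (perPoly (Fin (k + 3)) ℂ) =
      MvPolynomial.C (α * c) + MvPolynomial.C β * transl (mrPoint ℂ k) T := by
    rw [hper, hdet, map_add, map_mul, map_mul, transl_C, transl_C, transl_C, ← C_mul]
  have hHess : hess0 (transl (mrPoint ℂ k) (perPoly (Fin (k + 3)) ℂ)) =
      β • hess0 (transl (mrPoint ℂ k) T) := by
    rw [e1, map_add, hess0_C_mul,
      hess0_eq_zero_of_totalDegree_le_one (by rw [totalDegree_C]; exact Nat.zero_le _), zero_add]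
  have hrank : (hess0 (transl (mrPoint ℂ k) T)).rank = (k + 3) ^ 2 := by
    rw [← rank_smul_eq hβ, ← hHess, hess0_transl_mrPoint_perPoly,
      rank_smul_eq (by exact_mod_cast Nat.factorial_ne_zero k), rank_mrHess]
  rw [hrank] at hrate
  calc (k + 3) ^ 3 = (k + 3) ^ 2 * (k + 3) := by ring
    _ ≤ C * m ^ 2 := hrate

end Summit.ValiantsHypothesis.ValiantsHypothesis.Cruxes.TwoDimCoefficients.DimTwoCases

end
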